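import Summits.QuantumFields.YangMills.Theorems.UnitScaleTiltProp7HDsolOfRowsT3
import Summits.QuantumFields.YangMills.Theorems.UnitScaleTiltProp7SectET3DeltaEtaExplicitT3
import HarnessLib

/-!
# Route `UnitScaleTilt`, crux «MinimiserStabilityRegPr» (stmt-QuantumFields-19200, stub EX, route (α)) — ROW `hΔsol` ([Balaban1985Variational] (136) + its `D*D` companion) AT THE T³
# MEMBER IN THE HILBERT LETTER OF RECORD: the (129)∕(130)-free pair of ✓`Prop7HDsolOfRows` (`…_noSplit`) with the hypothesis `hEq` RE-STATED ON brick L0b's `Δ^η = DeltaEta` —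
# «`Δ^η A′₁ = −P₀*J + P₀*Δ⁽²⁾A′₁ − P₀*V′(A′₁) + Q*((QGQ*)⁻¹ − a)B̃`» read back on the carrier — and the (3.69)-row `hΔp` DISCHARGED by ★px5's «Δ310-EXPLICIT»
# (✓`Prop7SectET3DeltaEtaExplicit.symm_DeltaEta_toL2_apply`, ✓`norm_deltaPrimeOp_le_of_regPr`, `c₃₆₉ = 28`)

Cell `ym3-torus` (HUMAN RULING D-0037, YM ladder rung R3 — YM₃ on T³, NOT d = 4, NOT Clay; YM gap NOT proved), width seat `ym3-torus-px16` (explicit-unit; ★w2-19200 g5 (G1)∕(G9);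
`--supports stmt-QuantumFields-19200 --as helper`, count-neutral; NO claim on crux∕stub∕registry).  THEOREMS ONLY (0 `def`, 0 `sorry`).  CONDITIONAL on the displayed rows below.

THE PRINT.  [Balaban1985Variational] (128) p. 297; (133)–(136) p. 298; (137) p. 298; [Balaban1985BackgroundPropagators] (3.10)–(3.12) p. 392 («⟨A,ΔA⟩ = ⟨A,D*DA⟩ + ⟨A,Δ′A⟩», «Δ is
hermitian»), (3.49) p. 399, (3.69) p. 404, (3.137) p. 424.

WHY (located in ✓`Prop7HDsolOfRows` §2).  At the one-level member, (128) on `ker Q` + `G = Δ_a⁻¹` + `QA′₁ = B̃` give `Δ_aA′₁ = P₀*(−J + Δ⁽²⁾A′₁ − V′(A′₁)) + Q*(QGQ*)⁻¹B̃`; (21) kills `DRD*A′₁`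
and `Q*aQA′₁ = aQ*B̃`, so `ΔA′₁ = −P₀*J + P₀*Δ⁽²⁾A′₁ − P₀*V′(A′₁) + Q*((QGQ*)⁻¹ − a)B̃` with `Δ = Δ^η(U₀)` THE WILSON HESSIAN — brick L0b's `DeltaEta`, in which the member's `G`, `H`,
`Δ_a`, `P₀` are typed.  ★px5's ✓`symm_DeltaEta_toL2_apply` reads `Δ^η` back on the carrier as `η⁻²·(D¹*D¹_{U₀} + Δ′₁)` (lit ✓`B9Eq310Hermitian.deltaOp∕deltaPrimeOp`), and
✓`norm_deltaPrimeOp_le_of_regPr` bounds `‖Δ′₁X‖ ≤ 28·ε₀η²·sup‖X‖` on `RegPr` — so `hEq`'s `YΔ := Δ′₁Y` and the row `hΔp` of the `_noSplit` pair are now a DEFINITION and a THEOREM.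

DISPLAYED ROWS (hypotheses; locus → supplier → ONE-LINE INHABITABILITY CHECK, ★★OWNER RULING g27-№9 (3)):
* `hEqΔ : ∀ b, (toL2)⁻¹(Δ^η(toL2 Y)) b = η⁻² • (−J′ + X₂ − X₃ + X137) b.dir b.src` — (128) resolved on `ker Q` IN THE HILBERT LETTER (`J′ = η²P₀*J`, `X₂ = η²P₀*Δ⁽²⁾A′₁`, `X₃ = η²P₀*V′(A′₁)`,
  `X137 = η²Q*((QGQ*)⁻¹ − a)B̃` as unit-lattice fields) → supplier: the member-level (128)⇒(133) algebra over `DeltaEta`∕`laplaceA (DeltaEtaSlot)`∕`GT`∕`HT`∕`Qk` (lit ✓`eq133_weak`, ℂ-port free)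
  fed by ✓`Prop7Crit127OfCrit93Split` (★px21) + ✓`Prop7SectET3H137Rows.laplaceA_HT_pi` (★px5) → CHECK: an identity DEFINING `X137` (say) from the other three, inhabited for every datum.
* `hJ hX₂ hX₃ hn hYsup h137 hB hDPD` — VERBATIM the rows of ✓`norm_covLapFormT_le_of_rows136_noSplit` ((28)×`P₀*`, (3.137)×`P₀*`, (97)×`P₀*`, sizes, (137)'s block letter, `|B|`, (3.49) via (21));
  CHECKS as listed there (`J′ X₂ X₃ X137 := 0` at `U₀ = 1`∕`Y = 0`∕`B̃ = 0`).
WHAT IS PROVED: ★★★`secondOrder_of_hessRow` — both second-order members of (19) for `Y`: `‖D¹*D¹_{U₀}Y‖ ≤ (p(cJ + θ₂B₁∕2 + C₄B₁²ε₀∕4) + c₁₃₇cB + 28ε₀·B₁∕2)·ε₀·η²` and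
`‖Δ¹_{U₀}Y‖ ≤ (that + k₄B₁∕2 + 2B₁ε₀)·ε₀·η²` — `hΔsol`'s residue is now {`hEqΔ`'s algebra, the n = 0 rows behind `P₀*`∕`(QGQ*)⁻¹` (`p`, `c₁₃₇`), (3.137) (`θ₂`), (97) (`prop4`), (3.49) (`k₄`)}.

HONEST SCOPE.  One scalar cancellation (`η²·η⁻² = 1`) + the landed bricks; rows NOT proved here; not a proof of any stub; nothing continuum ∕ OS ∕ mass-gap ∕ Clay.

References: T. Bałaban, CMP **102** (1985) 277–309 [Balaban1985Variational] ((128) p.297, (133)–(137) p.298, (19) p.281); CMP **99** (1985) 389–434 [Balaban1985BackgroundPropagators]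
((3.10)–(3.12) p.392, (3.49) p.399, (3.69) p.404, (3.137) p.424).
-/

set_option autoImplicit false

noncomputable section

open scoped Matrix.Norms.L2Operator

namespace Summit.QuantumFields.YangMills.Theorems.Prop7HDsolOfRows

open Literature.MathematicalPhysics.QuantumFieldTheory.Balaban1983to89
open Literature.MathematicalPhysics.QuantumFieldTheory.Balaban1983to89.T3ContinuumYM3Torus
open Literature.MathematicalPhysics.QuantumFieldTheory.Balaban1983to89.T3PrintedRegularMinimiser (RegPr)
open T3SectALandauChart (covDerivFwdT formComp covCodiffCurlT covLapFormT covDivFormT bgUnits eta eta_pos)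
open B9TorusCalculus (torusT)
open B9Eq310Hermitian (deltaPrimeOp)
open Summit.QuantumFields.YangMills.Theorems.Prop7SectET3HilbertLetters (toL2)
open Summit.QuantumFields.YangMills.Theorems.Prop7SectET3WilsonHessian (DeltaEta)
open Summit.QuantumFields.YangMills.Theorems.Prop7SectET3DeltaEtaExplicit (symm_DeltaEta_toL2_apply norm_deltaPrimeOp_le_of_regPr)

variable (F : T3Family) (n K : ℕ) (c₀ : ℝ) [Fact (0 < c₀)]

/-- ★★★ **`hΔsol` IN THE HILBERT LETTER OF RECORD**: for a one-form `Y = ι(A′₁)` on a printed-regular background whose Wilson-Hessian image satisfies (128) resolved on `ker Q`,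
`(toL2)⁻¹(Δ^η_{U₀}(toL2 Y)) = η⁻²·(−J′ + X₂ − X₃ + X137)` (`hEqΔ`), with the displayed bound rows of ✓`norm_covLapFormT_le_of_rows136_noSplit` except `hΔp` (now the theorem
✓`norm_deltaPrimeOp_le_of_regPr`, `k₃ := 28ε₀`): BOTH second-order members of (19)∕`nMax19`,
`‖(D¹*D¹_{U₀}Y)_μ(x)‖ ≤ (p(cJ + θ₂B₁∕2 + C₄B₁²ε₀∕4) + c₁₃₇cB + 28ε₀B₁∕2)·ε₀·η²` and `‖(Δ¹_{U₀}Y)_ν(x)‖ ≤ (that + k₄B₁∕2 + 2B₁ε₀)·ε₀·η²`.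
[cite: Balaban1985Variational, (128) p.297, (133)–(137) p.298; Balaban1985BackgroundPropagators, (3.10)–(3.12) p.392, (3.69) p.404, (3.49) p.399] -/
theorem secondOrder_of_hessRow {ε₀ : ℝ} (hε₀ : 0 ≤ ε₀) (U₀ : GaugeField (F.P K) 0 (Matrix.specialUnitaryGroup (Fin 2) ℂ)) (hU₀ : RegPr F n K ε₀ U₀)
    (Y : PBond (F.P K) 0 → Matrix (Fin 2) (Fin 2) ℂ) (J' X₂ X₃ X137 : Fin (F.P K).d → Site (F.P K) 0 → Matrix (Fin 2) (Fin 2) ℂ)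
    (hEqΔ : ∀ b : PBond (F.P K) 0, (toL2 F K c₀).symm (DeltaEta F n K c₀ U₀ (toL2 F K c₀ Y)) b
      = ((((eta F n K)⁻¹ ^ 2 : ℝ) : ℂ)) • (-J' b.dir b.src + X₂ b.dir b.src - X₃ b.dir b.src + X137 b.dir b.src))
    {p cJ θ₂ C₄ B₁ nY c₁₃₇ nB cB k₄ : ℝ} (hp : 0 ≤ p) (hθ₂ : 0 ≤ θ₂) (hC₄ : 0 ≤ C₄) (hnY : 0 ≤ nY) (hc : 0 ≤ c₁₃₇) (hk₄ : 0 ≤ k₄)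
    (hJ : ∀ μ x, ‖J' μ x‖ ≤ p * cJ * ε₀ * eta F n K ^ 2) (hX₂ : ∀ μ x, ‖X₂ μ x‖ ≤ p * θ₂ * nY * eta F n K ^ 2)
    (hX₃ : ∀ μ x, ‖X₃ μ x‖ ≤ p * C₄ * nY ^ 2 * eta F n K ^ 2) (hn : nY ≤ B₁ / 2 * ε₀) (hYsup : ∀ b, ‖Y b‖ ≤ nY)
    (h137 : ∀ μ x, ‖X137 μ x‖ ≤ c₁₃₇ * nB * eta F n K ^ 2) (hB : nB ≤ cB * ε₀)
    (hDPD : ∀ μ x, ‖covDerivFwdT 1 (bgUnits F K U₀) μ (covDivFormT 1 (bgUnits F K U₀) Y) x‖ ≤ k₄ * nY * eta F n K ^ 2) :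
    (∀ (μ : Fin (F.P K).d) (x : Site (F.P K) 0),
        ‖covCodiffCurlT 1 (bgUnits F K U₀) Y μ x‖ ≤ (p * (cJ + θ₂ * B₁ / 2 + C₄ * B₁ ^ 2 * ε₀ / 4) + c₁₃₇ * cB + 28 * ε₀ * B₁ / 2) * ε₀ * eta F n K ^ 2) ∧
    (∀ (ν : Fin (F.P K).d) (x : Site (F.P K) 0),
        ‖covLapFormT 1 (bgUnits F K U₀) Y ν x‖
          ≤ (p * (cJ + θ₂ * B₁ / 2 + C₄ * B₁ ^ 2 * ε₀ / 4) + c₁₃₇ * cB + 28 * ε₀ * B₁ / 2 + k₄ * B₁ / 2 + 2 * B₁ * ε₀) * ε₀ * eta F n K ^ 2) := by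
  -- the unit-lattice `Δ′₁Y` as the fifth field, and `hEq` of the `_noSplit` pair from `hEqΔ` + Δ310-EXPLICIT
  set YΔ : Fin (F.P K).d → Site (F.P K) 0 → Matrix (Fin 2) (Fin 2) ℂ :=
    fun μ x => deltaPrimeOp (torusT (F.P K) 0) (fun μ x => bgUnits F K U₀ ⟨x, μ⟩) 1 (formComp Y) μ x with hYΔ
  have hη : (eta F n K) ≠ 0 := (eta_pos F n K).ne'
  have hsc : ((((eta F n K)⁻¹ ^ 2 : ℝ) : ℂ)) ≠ 0 := by
    exact_mod_cast (pow_ne_zero 2 (inv_ne_zero hη))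
  have hEq : ∀ (μ : Fin (F.P K).d) (x : Site (F.P K) 0),
      covCodiffCurlT 1 (bgUnits F K U₀) Y μ x = -J' μ x + X₂ μ x - X₃ μ x + X137 μ x - YΔ μ x := by
    intro μ x
    have h1 := hEqΔ ⟨x, μ⟩
    rw [symm_DeltaEta_toL2_apply] at h1
    have h2 := smul_right_injective _ hsc h1
    -- `h2 : D*DY + Δ′₁Y = −J′ + X₂ − X₃ + X137` at the bond `⟨x, μ⟩`
    have h3 : covCodiffCurlT 1 (bgUnits F K U₀) Y μ x + YΔ μ x = -J' μ x + X₂ μ x - X₃ μ x + X137 μ x := by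
      simpa only [hYΔ] using h2
    rw [← h3, add_sub_cancel_right]
  have hk₃ : 0 ≤ 28 * ε₀ := by positivity
  have hΔp : ∀ μ x, ‖YΔ μ x‖ ≤ 28 * ε₀ * nY * eta F n K ^ 2 := by
    intro μ x
    have h := norm_deltaPrimeOp_le_of_regPr U₀ hU₀ hYsup μ x
    simp only [hYΔ]
    linarith [h]
  refine ⟨fun μ x => ?_, fun ν x => ?_⟩
  · have h := norm_covCodiffCurlT_le_of_rows136_noSplit F n K U₀ Y J' X₂ X₃ X137 YΔ hEq hp hθ₂ hC₄ hnY hc hk₃ hJ hX₂ hX₃ hn h137 hB hΔp μ x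
    refine h.trans (le_of_eq ?_); ring
  · have h := norm_covLapFormT_le_of_rows136_noSplit F n K hε₀ U₀ hU₀ Y J' X₂ X₃ X137 YΔ hEq hp hθ₂ hC₄ hnY hc hk₃ hk₄ hJ hX₂ hX₃ hn hYsup h137 hB hΔp hDPD ν x
    refine h.trans (le_of_eq ?_); ring

end Summit.QuantumFields.YangMills.Theorems.Prop7HDsolOfRows

end
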